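import Mathlib.RingTheory.Ideal.Maps
import Mathlib.Algebra.Algebra.Hom
import HarnessLib

/-!
# Cyclic representability of `Hom_A(Q, –)` on the chart `D(f)`

Topic `RingTheory/Localization`; namespace `Literature.RingTheory.Localization.CyclicChart` (generic commutative algebra; first consumer:
the M13 see-saw node N1 of cell hodgecm-mathlib — B-p01 (g11) spec (β), hand A-p06 (g12)).  Definitions with bodies (`cyclicAnn`, an
ideal; `evalHom`, `evalEquiv`, linear maps) and proved theorems; Mathlib-only imports; no named fact, no instance, no `sorry`.

* `cyclicAnn f q = {a | ∃ n, fⁿ a q = 0}` (the annihilator of `q` after inverting `f`, contracted to `A`) and, for every `A`-algebra `B`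
  in which `f` is a unit and a module `Q` with `∀ x, ∃ n a, fⁿ x = a q` (`Q_f` cyclic on `q`),
  **`evalEquiv : (Q →ₗ[A] B) ≃ₗ[B] Ann_B(cyclicAnn f q · B)`, `ℓ ↦ ℓ q`** ([AtiyahMacdonald1969, Prop. 3.14 p. 43];
  [EGA I (1971), (1.3.7)–(1.3.9)]), with its naturality along `A`-algebra maps `φ : B →ₐ[A] C` and the value formula for `evalEquiv.symm`.
* two monoid identities for fractions `t⁻ⁿ a` written with a chosen inverse of `t` (`inv_pow_add_mul`, `inv_pow_mul_eq_of_pow_mul_eq`).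

## References
* [AtiyahMacdonald1969] M. F. Atiyah, I. G. Macdonald, *Introduction to Commutative Algebra* (1969), Chap. 3 p. 36, Prop. 3.14 p. 43.
-/

set_option autoImplicit false

universe u v w w'

namespace Literature.RingTheory.Localization.CyclicChart

/-! ## Two monoid identities for fractions `t⁻ⁿ a` written with a chosen inverse `v` of `t` -/

section Fractions

variable {M : Type w} [CommMonoid M] {t v : M}

/-- `v^{i+j} (tⁱ R) = vʲ R` when `v t = 1`. [cite: AtiyahMacdonald1969, Chap. 3 p. 36] -/
theorem inv_pow_add_mul (htv : v * t = 1) (i j : ℕ) (R : M) : v ^ (i + j) * (t ^ i * R) = v ^ j * R := by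
  rw [pow_add, mul_mul_mul_comm, ← mul_pow, htv, one_pow, one_mul]

/-- `tᵐ P = tᵏ R ⇒ vᵏ P = vᵐ R` when `v t = 1` (equality of the fractions `t⁻ᵏ P = t⁻ᵐ R`). [cite: AtiyahMacdonald1969, Chap. 3 p. 36] -/
theorem inv_pow_mul_eq_of_pow_mul_eq (htv : v * t = 1) {m k : ℕ} {P R : M} (h : t ^ m * P = t ^ k * R) :
    v ^ k * P = v ^ m * R := by
  rw [← inv_pow_add_mul htv m k P, h, add_comm, inv_pow_add_mul htv k m R]

end Fractions

/-! ## (β) Cyclic representability of `Hom_A(Q, –)` on the chart `D(f)` -/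

section Cyclic

variable {A : Type u} [CommRing A] {Q : Type v} [AddCommGroup Q] [Module A Q] (f : A) (q : Q)

/-- **the contracted annihilator of `q` on `D(f)`**: `cyclicAnn f q = {a : A | ∃ n, f ^ n • a • q = 0}`.
[cite: AtiyahMacdonald1969, Prop. 3.14 p. 43] -/
def cyclicAnn : Ideal A where
  carrier := {a : A | ∃ n : ℕ, f ^ n • a • q = 0}
  add_mem' := by
    rintro a b ⟨n, hn⟩ ⟨m, hm⟩
    refine ⟨n + m, ?_⟩
    rw [add_smul, smul_add, pow_add, mul_smul, mul_smul, hm, smul_zero, add_zero, smul_comm (f ^ n) (f ^ m) (a • q), hn,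
      smul_zero]
  zero_mem' := ⟨0, by rw [zero_smul, smul_zero]⟩
  smul_mem' := by
    rintro c a ⟨n, hn⟩
    exact ⟨n, by rw [smul_eq_mul, mul_smul, smul_comm (f ^ n) c (a • q), hn, smul_zero]⟩

variable {f q} in
/-- membership in `cyclicAnn f q`. [cite: AtiyahMacdonald1969, Prop. 3.14 p. 43] -/
theorem mem_cyclicAnn {a : A} : a ∈ cyclicAnn f q ↔ ∃ n : ℕ, f ^ n • a • q = 0 := Iff.rfl

variable {f q} in
/-- `a • q = 0 ⇒ a ∈ cyclicAnn f q` (exponent `0`). [cite: AtiyahMacdonald1969, Prop. 3.14 p. 43] -/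
theorem mem_cyclicAnn_of_smul_eq_zero {a : A} (h : a • q = 0) : a ∈ cyclicAnn f q := ⟨0, by rw [pow_zero, one_smul, h]⟩

variable {f q} in
/-- two fractions `f⁻ⁿ a`, `f⁻ᵐ a′` representing the same `x` (`fⁿ x = a q`, `fᵐ x = a′ q`) differ by an element of `cyclicAnn f q`:
`f ^ m * a - f ^ n * a′ ∈ cyclicAnn f q`. [cite: AtiyahMacdonald1969, Prop. 3.14 p. 43] -/
theorem sub_mem_cyclicAnn_of_eq {x : Q} {n m : ℕ} {a a' : A} (h : f ^ n • x = a • q) (h' : f ^ m • x = a' • q) :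
    f ^ m * a - f ^ n * a' ∈ cyclicAnn f q :=
  mem_cyclicAnn_of_smul_eq_zero (by
    rw [sub_smul, mul_smul, mul_smul, ← h, ← h', smul_comm (f ^ m) (f ^ n) x, sub_self])

variable (B : Type w) [CommRing B] [Algebra A B]

variable {f q B} in
/-- **`ℓ q` is killed by `cyclicAnn f q · B`** when `f` is a unit in `B`: from `fⁿ a q = 0`, `φ(f)ⁿ · φ(a) ℓ(q) = ℓ(fⁿ a q) = 0`.
[cite: AtiyahMacdonald1969, Prop. 3.14 p. 43] -/
theorem apply_mem_annihilator_map_cyclicAnn (hf : IsUnit (algebraMap A B f)) (ℓ : Q →ₗ[A] B) :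
    ℓ q ∈ ((cyclicAnn f q).map (algebraMap A B)).annihilator := by
  refine (Submodule.mem_annihilator_span _ _).2 ?_
  rintro ⟨_, a, ⟨n, hn⟩, rfl⟩
  have h0 : algebraMap A B f ^ n * (ℓ q * algebraMap A B a) = 0 := by
    have := congrArg ℓ hn
    rw [map_zero, ← mul_smul, LinearMap.map_smul_of_tower, Algebra.smul_def, map_mul, map_pow] at this
    rw [mul_comm (ℓ q), ← mul_assoc]
    exact this
  rw [smul_eq_mul]
  exact (hf.pow n).mul_right_eq_zero.1 h0

/-- **evaluation at `q`**, `ℓ ↦ ℓ q : Hom_A(Q, B) →ₗ[B] Ann_B(cyclicAnn f q · B)`. [cite: AtiyahMacdonald1969, Prop. 3.14 p. 43] -/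
def evalHom (hf : IsUnit (algebraMap A B f)) :
    (Q →ₗ[A] B) →ₗ[B] ((cyclicAnn f q).map (algebraMap A B)).annihilator where
  toFun ℓ := ⟨ℓ q, apply_mem_annihilator_map_cyclicAnn hf ℓ⟩
  map_add' _ _ := rfl
  map_smul' _ _ := rfl

/-- value of `evalHom`. [cite: AtiyahMacdonald1969, Prop. 3.14 p. 43] -/
@[simp] theorem coe_evalHom_apply (hf : IsUnit (algebraMap A B f)) (ℓ : Q →ₗ[A] B) :
    (evalHom f q B hf ℓ : B) = ℓ q := rfl

variable {f q B} in
/-- **the fraction formula**: `fⁿ x = a q ⇒ φ(f)ⁿ ℓ(x) = φ(a) ℓ(q)`. [cite: AtiyahMacdonald1969, Prop. 3.14 p. 43] -/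
theorem pow_mul_apply_eq (ℓ : Q →ₗ[A] B) {x : Q} {n : ℕ} {a : A} (h : f ^ n • x = a • q) :
    algebraMap A B f ^ n * ℓ x = algebraMap A B a * ℓ q := by
  have := congrArg ℓ h
  rwa [LinearMap.map_smul_of_tower, LinearMap.map_smul_of_tower, Algebra.smul_def, Algebra.smul_def, map_pow] at this

variable {f q B} in
/-- **injectivity of evaluation** on a module cyclic on `q` after inverting `f`. [cite: AtiyahMacdonald1969, Prop. 3.14 p. 43] -/
theorem evalHom_injective (hf : IsUnit (algebraMap A B f)) (hcyc : ∀ x : Q, ∃ (n : ℕ) (a : A), f ^ n • x = a • q) :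
    Function.Injective (evalHom f q B hf) := by
  intro ℓ ℓ' h
  have hq : ℓ q = ℓ' q := congrArg Subtype.val h
  ext x
  obtain ⟨n, a, hx⟩ := hcyc x
  have h1 := pow_mul_apply_eq ℓ hx
  have h2 := pow_mul_apply_eq ℓ' hx
  rw [hq, ← h2] at h1
  exact (hf.pow n).mul_left_cancel h1

variable {f q B} in
/-- **a value killed by `cyclicAnn f q · B` defines a functional**: for `b ∈ Ann_B(cyclicAnn f q · B)` there is `ℓ : Q →ₗ[A] B` with
`ℓ q = b`, namely `ℓ x = φ(f)⁻ⁿ φ(a) b` for any representation `fⁿ x = a q`. [cite: AtiyahMacdonald1969, Prop. 3.14 p. 43] -/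
theorem evalHom_surjective (hf : IsUnit (algebraMap A B f)) (hcyc : ∀ x : Q, ∃ (n : ℕ) (a : A), f ^ n • x = a • q) :
    Function.Surjective (evalHom f q B hf) := by
  classical
  rintro ⟨b, hb⟩
  choose n a hna using hcyc
  obtain ⟨v, hv⟩ := hf.exists_left_inv
  have hkill : ∀ c ∈ cyclicAnn f q, algebraMap A B c * b = 0 := fun c hc => by
    have := (Submodule.mem_annihilator.1 hb) (algebraMap A B c) (Ideal.mem_map_of_mem _ hc)
    rwa [smul_eq_mul, mul_comm] at this
  -- the value formula: the candidate `x ↦ v^{n x} φ(a x) b` does not depend on the chosen representation `f^{n x} x = a x • q`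
  have hval : ∀ (x : Q) (m : ℕ) (c : A), f ^ m • x = c • q →
      v ^ n x * (algebraMap A B (a x) * b) = v ^ m * (algebraMap A B c * b) := by
    intro x m c hx
    have hsub := hkill _ (sub_mem_cyclicAnn_of_eq (hna x) hx)
    rw [map_sub, sub_mul, sub_eq_zero, map_mul, map_mul, map_pow, map_pow, mul_assoc, mul_assoc] at hsub
    exact inv_pow_mul_eq_of_pow_mul_eq hv hsub
  refine ⟨{ toFun := fun x => v ^ n x * (algebraMap A B (a x) * b)
            map_add' := fun x y => ?_
            map_smul' := fun c x => ?_ }, ?_⟩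
  · -- additivity: read `x`, `y`, `x + y` with the common exponent `n x + n y`
    have hx' : f ^ (n x + n y) • x = (f ^ n y * a x) • q := by
      rw [pow_add, mul_smul, smul_comm (f ^ n x) (f ^ n y) x, hna x, ← mul_smul]
    have hy' : f ^ (n x + n y) • y = (f ^ n x * a y) • q := by
      rw [pow_add, mul_smul, hna y, ← mul_smul]
    have hxy : f ^ (n x + n y) • (x + y) = (f ^ n y * a x + f ^ n x * a y) • q := by
      rw [smul_add, hx', hy', ← add_smul]
    show v ^ n (x + y) * (algebraMap A B (a (x + y)) * b) =
      v ^ n x * (algebraMap A B (a x) * b) + v ^ n y * (algebraMap A B (a y) * b)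
    rw [hval (x + y) _ _ hxy, hval x _ _ hx', hval y _ _ hy', map_add, add_mul, mul_add]
  · -- `A`-linearity: read `c • x` with the exponent `n x`
    have hcx : f ^ n x • (c • x) = (c * a x) • q := by rw [smul_comm, hna x, ← mul_smul]
    show v ^ n (c • x) * (algebraMap A B (a (c • x)) * b) = (RingHom.id A c) • (v ^ n x * (algebraMap A B (a x) * b))
    rw [hval (c • x) _ _ hcx, RingHom.id_apply, Algebra.smul_def, map_mul]
    ring
  · -- value at `q`: read `q` with exponent `0` and coefficient `1`
    apply Subtype.ext
    show v ^ n q * (algebraMap A B (a q) * b) = b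
    rw [hval q 0 1 (by rw [pow_zero]), pow_zero, one_mul, map_one, one_mul]

/-- **CYCLIC REPRESENTABILITY on the chart `D(f)`**: for an `A`-algebra `B` in which `f` is a unit and a module `Q` cyclic on `q` after
inverting `f`, evaluation at `q` is a `B`-linear isomorphism `Hom_A(Q, B) ≃ Ann_B(cyclicAnn f q · B)`.
[cite: AtiyahMacdonald1969, Prop. 3.14 p. 43] -/
noncomputable def evalEquiv (hf : IsUnit (algebraMap A B f)) (hcyc : ∀ x : Q, ∃ (n : ℕ) (a : A), f ^ n • x = a • q) :
    (Q →ₗ[A] B) ≃ₗ[B] ((cyclicAnn f q).map (algebraMap A B)).annihilator :=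
  LinearEquiv.ofBijective (evalHom f q B hf) ⟨evalHom_injective hf hcyc, evalHom_surjective hf hcyc⟩

/-- `evalEquiv ℓ = ℓ q`. [cite: AtiyahMacdonald1969, Prop. 3.14 p. 43] -/
@[simp] theorem coe_evalEquiv_apply (hf : IsUnit (algebraMap A B f)) (hcyc : ∀ x : Q, ∃ (n : ℕ) (a : A), f ^ n • x = a • q)
    (ℓ : Q →ₗ[A] B) : (evalEquiv f q B hf hcyc ℓ : B) = ℓ q := rfl

/-- `evalEquiv.symm b` evaluates to `b` at `q`. [cite: AtiyahMacdonald1969, Prop. 3.14 p. 43] -/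
@[simp] theorem evalEquiv_symm_apply_self (hf : IsUnit (algebraMap A B f))
    (hcyc : ∀ x : Q, ∃ (n : ℕ) (a : A), f ^ n • x = a • q) (b : ((cyclicAnn f q).map (algebraMap A B)).annihilator) :
    (evalEquiv f q B hf hcyc).symm b q = (b : B) :=
  congrArg Subtype.val ((evalEquiv f q B hf hcyc).apply_symm_apply b)

/-- **the fraction formula for `evalEquiv.symm`**: if `fⁿ x = a q` then `φ(f)ⁿ · (evalEquiv.symm b) x = φ(a) · b`. [cite: AtiyahMacdonald1969, Prop. 3.14 p. 43] -/
theorem pow_mul_evalEquiv_symm_apply (hf : IsUnit (algebraMap A B f))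
    (hcyc : ∀ x : Q, ∃ (n : ℕ) (a : A), f ^ n • x = a • q) (b : ((cyclicAnn f q).map (algebraMap A B)).annihilator)
    {x : Q} {n : ℕ} {a : A} (h : f ^ n • x = a • q) :
    algebraMap A B f ^ n * (evalEquiv f q B hf hcyc).symm b x = algebraMap A B a * (b : B) := by
  rw [pow_mul_apply_eq _ h, evalEquiv_symm_apply_self]

variable (C : Type w') [CommRing C] [Algebra A C]

variable {B C} in
/-- an `A`-algebra map carries `Ann_B(I·B)` into `Ann_C(I·C)`. [cite: AtiyahMacdonald1969, Prop. 3.14 p. 43, Ex. 1.18] -/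
theorem map_mem_annihilator_map (φ : B →ₐ[A] C) {I : Ideal A} {b : B} (hb : b ∈ (I.map (algebraMap A B)).annihilator) :
    φ b ∈ (I.map (algebraMap A C)).annihilator := by
  refine (Submodule.mem_annihilator_span _ _).2 ?_
  rintro ⟨_, a, ha, rfl⟩
  have h := (Submodule.mem_annihilator.1 hb) _ (Ideal.mem_map_of_mem (algebraMap A B) ha)
  rw [smul_eq_mul] at h
  show φ b * algebraMap A C a = 0
  rw [← φ.commutes, ← map_mul, h, map_zero]

/-- **NATURALITY of `evalEquiv`** along an `A`-algebra map `φ : B →ₐ[A] C` (with `f` a unit on both sides):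
`evalEquiv_C (φ ∘ ℓ) = φ (evalEquiv_B ℓ)`. [cite: AtiyahMacdonald1969, Prop. 3.14 p. 43] -/
theorem coe_evalEquiv_comp (hfB : IsUnit (algebraMap A B f)) (hfC : IsUnit (algebraMap A C f))
    (hcyc : ∀ x : Q, ∃ (n : ℕ) (a : A), f ^ n • x = a • q) (φ : B →ₐ[A] C) (ℓ : Q →ₗ[A] B) :
    (evalEquiv f q C hfC hcyc (φ.toLinearMap.restrictScalars A ∘ₗ ℓ) : C) = φ (evalEquiv f q B hfB hcyc ℓ : B) := rfl

/-- naturality for `evalEquiv.symm`: `φ ∘ evalEquiv_B.symm b = evalEquiv_C.symm (φ b)`. [cite: AtiyahMacdonald1969, Prop. 3.14 p. 43] -/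
theorem restrictScalars_comp_evalEquiv_symm (hfB : IsUnit (algebraMap A B f)) (hfC : IsUnit (algebraMap A C f))
    (hcyc : ∀ x : Q, ∃ (n : ℕ) (a : A), f ^ n • x = a • q) (φ : B →ₐ[A] C)
    (b : ((cyclicAnn f q).map (algebraMap A B)).annihilator) :
    φ.toLinearMap.restrictScalars A ∘ₗ (evalEquiv f q B hfB hcyc).symm b =
      (evalEquiv f q C hfC hcyc).symm ⟨φ b, map_mem_annihilator_map φ b.2⟩ := by
  apply (evalEquiv f q C hfC hcyc).injective
  apply Subtype.ext
  rw [LinearEquiv.apply_symm_apply, coe_evalEquiv_apply]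
  show φ ((evalEquiv f q B hfB hcyc).symm b q) = φ b
  rw [evalEquiv_symm_apply_self]

end Cyclic

end Literature.RingTheory.Localization.CyclicChart
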